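import Literature.AnabelianGeometry.AbsoluteAnabelian.GaloisCyclotomeZHatOne
import Literature.NumberTheory.GaloisRepresentations.LocalFieldPadicProofs
import Summits.ABC.IUTFork.LanaCyclotomes
import HarnessLib

/-!
# L-LANA objects X bis: LANA's local cyclotomic rigidity `ι_{G↷M} : Λ(O^×_v) ⥲ Λ(G_v)` EXISTS (from layer L4's LCFT)

Record-only sequel (D-0012; seat abc-iut-c312-4 gen 5, L-LANA level, plan/LLANA-SPEC N2/N9, RESIDUAL-LANA row
`LanaCyclotomes.lean:86 LocalCyclotomicRigidity` = IFACE/HYP) of `LanaCyclotomes.lean` (gen 0); TAKES NO SIDE on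
[IUTchIII] Cor. 3.12. LANA §6.3 (6-5) p. 37: "from `G` as well, the cyclotome `Λ(G) := Λ(M(G))` is reconstructed
… Cyclotomic rigidity is the canonical isomorphism between these two cyclotomes `ι_{G↷M} : Λ(M) ⥲ Λ(G)`"; gen 0
typed it as the INTERFACE `LocalCyclotomicRigidity G M ΛG` (a `G`-equivariant `Λ(M) ⥲ ΛG` for a `G`-side
cyclotome `ΛG` "reconstructed from `G` alone"). Layer L4 has since CONSTRUCTED the `G`-side cyclotome and the
comparison: abc-iut-L4-t1's group-theoretic `μ_Ẑ(G) = muZhat G` ([AbsTopIII] Cor. 1.10 (i)(a):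
`μ_{ℚ/ℤ}(G) := lim_{→ H} (H^ab)_tors` along the Verlagerung, `μ_Ẑ := Hom(ℚ/ℤ, −)` — pure topological group
theory, `GaloisCyclotome.lean`) with its conjugation action (`GaloisCyclotomeAction.lean`), and the
`G_k`-equivariant identification `TorsionReciprocityData.muZhatEquiv : μ_Ẑ(G_k) ⥲ Λ(k̄ˣ)` from torsion
reciprocity data, which EXIST for every non-archimedean local field of characteristic `0`
(`nonempty_torsionReciprocityData`, abc-iut-L6-t11 — local class field theory as proved in the tree;
`GaloisCyclotomeZHatOne.lean`). THIS file plugs them into LANA's interface: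

* `unitCyclotomeEquiv w : Λ(O^×) ⥲ Λ(K^×)` — for ANY valued field, roots of unity are units of valuation `1`,
  so the cyclotome of `O^× = unitGrp w` IS the cyclotome of `K^×` (componentwise the inclusion);
* **`LocalCyclotomicRigidity.ofReciprocity D w`** — for `k` of characteristic `0`, torsion reciprocity data `D`
  and any `G_k`-invariant valuation `w` on `k̄`: LANA's `ι_{G_k ↷ O^×} : Λ(O^×_{k̄}) ⥲ μ_Ẑ(G_k)`, `G_k`-EQUIVARIANT,
  with `ΛG := μ_Ẑ(G_k)` genuinely "reconstructed from `G` alone";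
* **`nonempty_localCyclotomicRigidity`** — hence the interface is INHABITED BY THE GENUINE OBJECTS at every
  non-archimedean local field of characteristic `0`; `nonempty_localCyclotomicRigidity_padic` — in particular at
  the `ℚ_p` reference datum of `LanaPadicGalois.lean` (`G_v = Gal(ℚ̄_p/ℚ_p)`, `| · | = padicVal p`).

So RESIDUAL-LANA's N2/N9 entry "Λ(O^×) from `G_v` ([AbsTopIII] Prop. 1.2-type content)" is REAL. What stays
LANA's point (§6.3 "without this rigidity … only its `Ẑ^×`-power orbit"): two rigidity isomorphisms differ by a
`G`-equivariant automorphism of `Λ(O^×)` (gen 0 `discrepancy_smul`) — canonicity is the content of the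
reciprocity data `D`, quantified away in the existence statements. The Θ-version (6-2) `Θ-Λ-rgd` is layer
L2/L6's (`EtaleThetaDataOfSettingKummerTower.exists_cyclotomeCoefficients_of_cyclotomeTower`), not here.
[cite: LANA2026Report, §6.3 (6-5) p. 37, §4.2 (b) p. 25] [cite: MochizukiAbsTopIII2015, Cor 1.10 (i) p.42]
NOT here: any judgement.
-/

noncomputable section

namespace Summit.ABC
namespace IUTFork

open Literature.AnabelianGeometry.EtaleTheta (cyclotome)
open Literature.AnabelianGeometry.AbsoluteAnabelian (TorsionReciprocityData muZhat nonempty_torsionReciprocityData)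
open scoped NNReal

/-! ## 1. `Λ(O^×) = Λ(K^×)`: roots of unity have valuation `1` -/

section UnitCyclotome

variable {K : Type} [Field K] {Γ₀ : Type} [LinearOrderedCommGroupWithZero Γ₀] (w : Valuation K Γ₀)

/-- A unit with a trivial positive power has valuation `1` (the value group of a valuation is torsion-free).
[folklore] -/
theorem val_eq_one_of_pow_eq_one {u : Kˣ} {n : ℕ} (hn : n ≠ 0) (h : u ^ n = 1) : w (u : K) = 1 := by
  have h' : w (u : K) ^ n = 1 := by
    rw [← map_pow, ← Units.val_pow_eq_pow_val, h, Units.val_one, map_one]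
  exact (pow_eq_one_iff_left hn).mp h'

/-- Every component of an element of `Λ(K^×)` lies in `O^×`. [cite: LANA2026Report, §4.2 (b) p. 25] -/
theorem cyclotome_apply_mem_unitGrp (ζ : cyclotome Kˣ) (n : ℕ+) : (ζ : ℕ+ → Kˣ) n ∈ unitGrp w :=
  (mem_unitGrp_iff w _).mpr (val_eq_one_of_pow_eq_one w n.ne_zero (cyclotome.pow_eq_one ζ n))

/-- **`Λ(O^×_v) ⥲ Λ(K̄_v^×)`**: the cyclotome of the units of valuation `1` is the cyclotome of the whole
multiplicative group (componentwise the inclusion `O^× ≤ K^×`; inverse by `cyclotome_apply_mem_unitGrp`).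
[cite: LANA2026Report, §4.2 (b) p. 25] -/
def unitCyclotomeEquiv : unitCyclotome w ≃* cyclotome Kˣ where
  toFun ζ := ⟨fun n => ((ζ : ℕ+ → unitGrp w) n : Kˣ),
    ⟨fun n => by
      have h := congrArg (fun x : unitGrp w => (x : Kˣ)) (cyclotome.pow_eq_one ζ n)
      simpa using h,
     fun n m => by
      have h := congrArg (fun x : unitGrp w => (x : Kˣ)) (cyclotome.pow_apply_mul ζ n m)
      simpa using h⟩⟩
  invFun ζ := ⟨fun n => ⟨(ζ : ℕ+ → Kˣ) n, cyclotome_apply_mem_unitGrp w ζ n⟩,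
    ⟨fun n => Subtype.ext (cyclotome.pow_eq_one ζ n), fun n m => Subtype.ext (cyclotome.pow_apply_mul ζ n m)⟩⟩
  left_inv ζ := Subtype.ext (funext fun _ => Subtype.ext rfl)
  right_inv ζ := Subtype.ext (funext fun _ => rfl)
  map_mul' ζ ξ := Subtype.ext (funext fun _ => rfl)

/-- Components of `unitCyclotomeEquiv`: the `n`-th component is the same unit. [folklore] -/
@[simp] theorem unitCyclotomeEquiv_apply_coe (ζ : unitCyclotome w) (n : ℕ+) :
    ((unitCyclotomeEquiv w ζ : cyclotome Kˣ) : ℕ+ → Kˣ) n = ((ζ : ℕ+ → unitGrp w) n : Kˣ) := rfl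

variable (G : Type) [Group G] [MulSemiringAction G K] [IsValPreserving w G]

/-- The `G`-action on `Λ(O^×)` read on field elements: the `n`-th component of `g • ζ` is `g •` the `n`-th
component of `ζ` (gen 0's `unitGrp` action is `Units.map` of the ring action). [cite: LANA2026Report, §4.2 (b) p. 25] -/
theorem unitCyclotome_smul_apply_coe (g : G) (ζ : unitCyclotome w) (n : ℕ+) :
    ((((g • ζ : unitCyclotome w) : ℕ+ → unitGrp w) n : Kˣ) : K) = g • ((((ζ : ℕ+ → unitGrp w) n : Kˣ) : K)) :=
  rfl

end UnitCyclotome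

/-! ## 2. `ι_{G_k ↷ O^×} : Λ(O^×_{k̄}) ⥲ μ_Ẑ(G_k)` from torsion reciprocity data -/

section Reciprocity

variable {k : Type} [Field k] [CharZero k] (D : TorsionReciprocityData k)
  {Γ₀ : Type} [LinearOrderedCommGroupWithZero Γ₀] (w : Valuation (AlgebraicClosure k) Γ₀)
  [IsValPreserving w (Field.absoluteGaloisGroup k)]

/-- LANA's `ι` as a bare isomorphism: `Λ(O^×_{k̄}) ⥲ Λ(k̄ˣ) ⥲ μ_Ẑ(G_k)` (the second arrow is the inverse of layer
L4's `muZhatEquiv`). [cite: LANA2026Report, §6.3 (6-5) p. 37] [cite: MochizukiAbsTopIII2015, Cor 1.10 (i) p.42] -/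
def iotaOfReciprocity : unitCyclotome w ≃* muZhat (Field.absoluteGaloisGroup k) :=
  (unitCyclotomeEquiv w).trans D.muZhatEquiv.symm

omit [IsValPreserving w (Field.absoluteGaloisGroup k)] in
/-- Under `D.muZhatEquiv`, LANA's `ι` of a compatible system of roots of unity in `O^×` is that system read in
`k̄ˣ` (the rigidity isomorphism is the tautological one composed with LCFT's identification).
[cite: LANA2026Report, §6.3 (6-5) p. 37] -/
theorem muZhatEquiv_iotaOfReciprocity (ζ : unitCyclotome w) :
    D.muZhatEquiv (iotaOfReciprocity D w ζ) = unitCyclotomeEquiv w ζ :=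
  D.muZhatEquiv.apply_symm_apply _

omit [IsValPreserving w (Field.absoluteGaloisGroup k)] in
/-- … so its `n`-th component, read in `k̄`, is the `n`-th component of `ζ`. [folklore] -/
theorem muZhatEquiv_iotaOfReciprocity_apply_coe (ζ : unitCyclotome w) (n : ℕ+) :
    ((((D.muZhatEquiv (iotaOfReciprocity D w ζ) : cyclotome (AlgebraicClosure k)ˣ) :
        ℕ+ → (AlgebraicClosure k)ˣ) n : (AlgebraicClosure k)ˣ) : AlgebraicClosure k) =
      ((((ζ : ℕ+ → unitGrp w) n : (AlgebraicClosure k)ˣ)) : AlgebraicClosure k) := by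
  rw [muZhatEquiv_iotaOfReciprocity, unitCyclotomeEquiv_apply_coe]

/-- **`ι` is `G_k`-EQUIVARIANT** (conjugation on `μ_Ẑ(G_k)`, the Galois action on `O^×_{k̄}`): read through
`D.muZhatEquiv`, both sides have `n`-th component `σ` applied to the `n`-th component of `ζ`
(`TorsionReciprocityData.muZhatEquiv_smul_coe`). [cite: MochizukiAbsTopIII2015, Cor 1.10 (i) p.42] -/
theorem iotaOfReciprocity_smul (σ : Field.absoluteGaloisGroup k) (ζ : unitCyclotome w) :
    iotaOfReciprocity D w (σ • ζ) = σ • iotaOfReciprocity D w ζ := by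
  apply D.muZhatEquiv.injective
  refine Subtype.ext (funext fun n => Units.ext ?_)
  rw [D.muZhatEquiv_smul_coe, muZhatEquiv_iotaOfReciprocity_apply_coe, muZhatEquiv_iotaOfReciprocity_apply_coe,
    unitCyclotome_smul_apply_coe]

/-- **LANA's local cyclotomic rigidity for the GENUINE objects**: `G := G_k = Gal(k̄/k)`, `M := O^×_{k̄}` (units of
valuation `1` for a `G_k`-invariant valuation), `ΛG := μ_Ẑ(G_k)` (layer L4's group-theoretic cyclotome,
"reconstructed from `G` alone"), `ι := iotaOfReciprocity D w`. [cite: LANA2026Report, §6.3 (6-5) p. 37]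
[cite: MochizukiAbsTopIII2015, Cor 1.10 (i) p.42] -/
def LocalCyclotomicRigidity.ofReciprocity :
    LocalCyclotomicRigidity (Field.absoluteGaloisGroup k) (unitGrp w) (muZhat (Field.absoluteGaloisGroup k)) where
  ι := iotaOfReciprocity D w
  ι_smul := iotaOfReciprocity_smul D w

end Reciprocity

/-! ## 3. Unconditional existence at every non-archimedean local field of characteristic `0`; the `ℚ_p` datum -/

/-- **LANA's interface `LocalCyclotomicRigidity` is inhabited by the genuine objects** (`G_k ↷ O^×_{k̄}`,
`ΛG = μ_Ẑ(G_k)`) at every non-archimedean local field `k` of characteristic `0` and every `G_k`-invariant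
valuation on `k̄` — torsion reciprocity data exist there (layer L4/L6: `nonempty_torsionReciprocityData`, local
class field theory). [cite: LANA2026Report, §6.3 (6-5) p. 37] [cite: MochizukiAbsTopIII2015, Cor 1.10 (i) p.42] -/
theorem nonempty_localCyclotomicRigidity (k : Type) [Field k] [CharZero k] [ValuativeRel k] [TopologicalSpace k]
    [IsNonarchimedeanLocalField k] {Γ₀ : Type} [LinearOrderedCommGroupWithZero Γ₀]
    (w : Valuation (AlgebraicClosure k) Γ₀) [IsValPreserving w (Field.absoluteGaloisGroup k)] :
    Nonempty (LocalCyclotomicRigidity (Field.absoluteGaloisGroup k) (unitGrp w)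
      (muZhat (Field.absoluteGaloisGroup k))) := by
  obtain ⟨D⟩ := nonempty_torsionReciprocityData k
  exact ⟨LocalCyclotomicRigidity.ofReciprocity D w⟩

/-- **At `k = ℚ_p`** (the field of the `ℚ_p` reference datum of `LanaPadicGalois.lean`: `K̄_v = ℚ̄_p = PadicAlgCl p =
AlgebraicClosure ℚ_p`; its `PadicGal p` / `padicVal p` are `Field.absoluteGaloisGroup ℚ_[p]` / a `G_v`-invariant
valuation up to Mathlib's definitional wrapper `Field.absoluteGaloisGroup`): for every `G_{ℚ_p}`-invariant valuation
`w` on `ℚ̄_p`, LANA's `ι_{G_v ↷ O^×_v} : Λ(O^×_v) ⥲ μ_Ẑ(G_v)` EXISTS, `G_v`-equivariant (`ℚ_p` is a non-archimedean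
local field: the tree's `Padic.isNonarchimedeanLocalField_holds`). [cite: LANA2026Report, §6.3 (6-5) p. 37] -/
theorem nonempty_localCyclotomicRigidity_padic (p : ℕ) [Fact p.Prime] {Γ₀ : Type} [LinearOrderedCommGroupWithZero Γ₀]
    (w : Valuation (AlgebraicClosure ℚ_[p]) Γ₀) [IsValPreserving w (Field.absoluteGaloisGroup ℚ_[p])] :
    Nonempty (LocalCyclotomicRigidity (Field.absoluteGaloisGroup ℚ_[p]) (unitGrp w)
      (muZhat (Field.absoluteGaloisGroup ℚ_[p]))) :=
  haveI := Literature.NumberTheory.GaloisRepresentations.Padic.isNonarchimedeanLocalField_holds p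
  nonempty_localCyclotomicRigidity ℚ_[p] w

end IUTFork

end Summit.ABC

end
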